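import Summits.QuantumFields.BalabanUV.Beta.FP.TowerWeightWords
import Summits.QuantumFields.BalabanUV.Beta.NVertexLamRoadCorePeriodised
import Summits.QuantumFields.BalabanUV.Beta.NVertexLamFold

/-!
# `BalabanUV.Beta.FP.TowerLamJunctionAssembly` — road «FP», binder row D1, ROUTE T (β1): **THE (J-Λ) SANDWICH ASSEMBLY — `hΛN` AT THE ROAD's DATA**:
# on the END wrapper's finest torus `T = towerTorus Lc (fine Lc M) (n+1)`, the wrapper's storey kernels summed and the row's Λ core have the SAME diagonal
# periodisation, `dper T (Σ_{j' ∈ range (n+2)} 𝒦_{j'}) = dper T ΛN`, for the road's storey data `cf ∕ hb ∕ w` of `FP/TowerHLinkRows` along the pinned direction `r•e_a`,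
# GIVEN the one scalar row `htop : w (n+1)·r = Pn.cΛ (n+2)` (R-FP-81) and the instantiation letters `hJW ∕ hhvl ∕ hfold` — the hypothesis `hΛN` of
# `FP/TorusLamJunctionShape.lamJunction_of_dper_eq` (g38), whence (J-Λ) and, by `FP/TorusNBindingOfJunctionsGauge` (E4d), the row `hHN₁`

WHY (`HOME/b2b-balaban-beta-d1-p3/g41/SPEC-52.md` §D.1; an2 W-1 l.67550, leaf-03 XV1∕XV2 l.67547∕l.67553).  Every brick is in the tree: the road's engine
`TorusTwoScaleSandwichLetters.dper_sandwich_apply` periodises a leg-sandwich as the sandwich of the periodised core; an2 PART 17 (`NVertexLamSectorPeriodisedStoreys`)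
writes the RIGHT side `dper T ΛN` as the storey sum `Σ_{k ∈ range (n+2)} dper (towerTorus Lc (towerTorus Lc (fine Lc M) (n+1−k)) k) 𝒦ᴿ_k` of plain-leg sandwiches of the
periodised row cores `𝒢ᴿ_k`, and gives the leg dictionary (`compLinKer_road_eq_scaled`: the road's legs = the record's legs × `Π_{i<k} stepScale 3 Lc (lev (n+1−i))·Lc⁴`);
an2 PART 19 (`NVertexLamRoadCorePeriodised.dper_slamCore_eq_dper_lamCoreR_of_word`) turns `σ · dper Tc (road core)` into `dper Tc 𝒢ᴿ_k` GIVEN the storey weight word,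
which is road g41's `TowerWeightWords.weight_word` (every storey, from `htop`).  THIS FILE is the index ∕ torus dictionary and the sum: with the row's storey index
`k` (= the leg depth) the road's storey is `n+1−k`, its storey torus `towerTorus Lc (fine Lc M) (n+1−k)` sits `k` levels below `T` (`towerTorus_sub_add`), the two leg
scalars make `σ_k = (Π_{i<k} …)²`, re-indexed to `weight_word`'s `(Π_{i ∈ Ico (n+1−k) (n+1)} stepScale 3 Lc (n+1−(i+1))·Lc⁴)²` by `lev i = n+1−i` (`legScalar_prod_eq`); the
storey sum on the left is re-indexed by `Finset.sum_range_reflect` and taken out of `dper T` termwise (each storey kernel's diagonal letter from the engine's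
`summable_sandwich_diag_of_tsum` and PART 19's `summable_slamCore_diag`, the latter under the slot letter `summable_cfF_slot`: an2 PART 25 `summable_cf_slot` at the top,
one non-zero slot below).

WHAT ([folklore] finite-sum ∕ `tsum` bookkeeping BY NAME; no `def`, no `def … : Prop`, nothing cited, 0 sorry; data binders `cfF hcfF hbF hhbF κF hκF wF hwF T' hT' hhvl lam
hJW hfold htop` VERBATIM as in `TowerWeightWords.weight_word` at `R := Roots.ctr Lc` (the wrapper's roots; `toSite (Roots.ctr Lc).r = ctr 4 Lc`, `rfl`), the storey-kernel
display `h𝒦` and brick list `hℓ` VERBATIM as in `lamJunction_of_dper_eq` at `cf := cfF`, `w := wF`, `hb j := hbF j (r•e_a)`, `𝒽 := symHessFFAt (toSite (Roots.ctr Lc).r) Lc`,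
with the wrapper's `lev i = n+1−i` displayed as `hlev`):
§1 `legScalar_prod_eq`, `summable_cfF_slot`; §2 (one storey, row index `k ≤ n+1`) `roadLeg_eq_zero_of_not_mem_box`, `roadLeg_translate`, `storeyKernel_display`,
`summable_roadCore_diag`, `summable_storeyKernel_diag`, **`dper_storeyKernel_eq_dper_storeySandwichR`** (`dper Tf (𝒦 (n+1−k)) = dper Tf 𝒦ᴿ_k` entrywise,
`Tf = towerTorus Lc (towerTorus Lc (fine Lc M) (n+1−k)) k`); §3 **`dper_sum_storeyKernels_eq_dper_lamN`** = `hΛN`.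
WHAT THIS IS NOT: not the instantiation letters `hJW` (g39 `TorusWJunctionOfNLeg` at the wrapper's pins), `hhvl`, `hfold` (an2 PART 25, in the tree), nor the scalar row
`htop`∕`hcΛ` (R-FP-81, a row of the (C1) instantiation) — all DISPLAYED; not `hHN₁` itself ((E4d) + `lamJunction_of_dper_eq` + this, at the instantiation); not (E4e); no row
of the END wrapper discharged here; 0 estimates; nothing of Bałaban's asserted, valued or discharged; 0∕4 row-D1 binders (hW, hR, D1Tel, D1Rep); ROOT M‴ p325680 ∕ P5c ∕ D6
untouched; NOT (C1), NOT (L2′), NOT (T-ID), NOT SDF, NOT D1, NEVER «G-an2-4 closed», NOT BetaPertH, NOT continuum, NOT Clay.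

HONEST DEPENDENCY (page 1, mandatory): continuum YM on T⁴ ⇐ BetaPertH ∧ nine spine estimates (0/9 proved); BetaPertH ⇐ (D1) ∧ (D4) ∧ CAP+tail;
G-an2-4 gates asym, D1 and NE2/3/4.  HONEST FRAMING (cell contract, verbatim): «discharging `BetaPertH` makes Bałaban's UV stability UNCONDITIONAL —
a real constructive-QFT result; it is NOT the continuum limit and NOT the Clay problem.»  ABSOLUTE RULE (cell charter, verbatim): «No internally-minted
statement may enter as a cited fact. Every hypothesis is either kernel-proved in this package or a verbatim quotation of a PUBLISHED theorem with page
reference. The manuscript(s) under audit are NOT citable for their own disputed steps — they are the thing under adjudication; programme-internal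
(2001/route/tribunal) claims are never citable.»  Road «FP» OWNER, b2b-balaban-beta-d1-p3 gen 42, 2026-08-27.  No existing file touched.
-/

noncomputable section

open scoped BigOperators

namespace Summit.QuantumFields.BalabanUV.Beta.FP.TowerLamJunctionAssembly

open Finset
open Literature.MathematicalPhysics.QuantumFieldTheory
open Literature.MathematicalPhysics.QuantumFieldTheory.Balaban1983to89
open Literature.MathematicalPhysics.QuantumFieldTheory.Balaban1983to89.Beta
open B4TorusKernel.MultiPeriod (translate)
open B5Prop11Plancherel (fine)
open B6Lemma24Torus (pbox)
open AffineAveraging (Site box toSite)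
open AveragingHessianKernels (Bond)
open AveragingContoursRooted (ctr)
open ExpKernelCalculus (MKer)
open OneStepResolventKernel (Fib KInv)
open InterLevelTransport (SLam)
open BalabanStepJets (lamCoeffOf)
open Summit.QuantumFields.BalabanUV.Beta.AxialDressingRooted (one_le_of_neZero)
open Summit.QuantumFields.BalabanUV.Beta.SymAveragingHessianCounts (symLinKerAt symHessKerAt symHessFFAt symLinKerAt_add)
open Summit.QuantumFields.BalabanUV.Beta.BorderedHessian (stepScale)
open Summit.QuantumFields.BalabanUV.Beta.CompositeVertexKernelRec (compLinKer wid)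
open Summit.QuantumFields.BalabanUV.Beta.CompositeOneShotJets (compH)
open Summit.QuantumFields.BalabanUV.Beta.CompositeOneShotJetData (Roots Pins AN)
open Summit.QuantumFields.BalabanUV.Beta.FP.KernelPeriodisationFib (perF)
open Summit.QuantumFields.BalabanUV.Beta.FP.KernelPeriodisationFibLoc (dper dper_apply)
open Summit.QuantumFields.BalabanUV.Beta.FP.TorusGaugeCovariance (tgrad)
open Summit.QuantumFields.BalabanUV.Beta.FP.TorusGaugeCovariancePairing (wrapPt)
open Summit.QuantumFields.BalabanUV.Beta.FP.TorusCompositeObjects (towerTorus)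
open Summit.QuantumFields.BalabanUV.Beta.FP.TorusTwoScaleSandwichLetters (dper_sandwich_apply sandwich_tsum_eq_window summable_sandwich_diag_of_tsum)
open Summit.QuantumFields.BalabanUV.Beta.NVertexLamSectorStoreyKernels (compLinKer_eq_zero_of_not_mem_box)
open Summit.QuantumFields.BalabanUV.Beta.NVertexLamCorePeriodised (towerTorus_fine_apply_eq)
open Summit.QuantumFields.BalabanUV.Beta.NVertexLamSectorPeriodisedStoreys (compLinKer_translate_of_sh compLinKer_road_eq_scaled dper_storeySandwichR_apply
  towerTorus_sub_add dper_lamN_eq_sum_dper_storeys)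
open Summit.QuantumFields.BalabanUV.Beta.NVertexLamRoadCorePeriodised (summable_slamCore_diag dper_slamCore_eq_dper_lamCoreR_of_word)
open Summit.QuantumFields.BalabanUV.Beta.NVertexLamFold (summable_cf_slot)
open Summit.QuantumFields.BalabanUV.Beta.FP.TowerWeightWords (weight_word)

variable {Lc : ℕ} [NeZero Lc] (n : ℕ) (M : Fin (3 + 1) → ℕ) [∀ i, NeZero (M i)]

/-! ## §1 The leg scalar re-indexed; the slot letter of the road's coefficient tables -/

section Scalars

variable (lev : ℕ → ℕ) (hlev : ∀ i ≤ n + 1, lev i = n + 1 - i)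

omit [NeZero Lc] in
include hlev in
/-- [folklore] **`legScalar_prod_eq` — THE ROAD's ONE-LEG SCALAR OF DEPTH `k`, RE-INDEXED**: at the wrapper's `lev i = n+1−i` (`i ≤ n+1`), for `k ≤ n+1`,
`Π_{i<k} stepScale 3 Lc (lev (n+1−i))·Lc⁴ = Π_{i ∈ Ico (n+1−k) (n+1)} stepScale 3 Lc (n+1−(i+1))·Lc⁴` (both are `Π_{i<k} stepScale 3 Lc i·Lc⁴`; `Finset.prod_Ico_reflect`). -/
theorem legScalar_prod_eq (k : ℕ) (hk : k ≤ n + 1) :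
    ∏ i ∈ Finset.range k, (stepScale 3 Lc (lev (n + 1 - i)) * (Lc : ℝ) ^ (3 + 1))
      = ∏ i ∈ Finset.Ico (n + 1 - k) (n + 1), (stepScale 3 Lc (n + 1 - (i + 1)) * (Lc : ℝ) ^ (3 + 1)) := by
  have h1 : ∏ i ∈ Finset.range k, (stepScale 3 Lc (lev (n + 1 - i)) * (Lc : ℝ) ^ (3 + 1))
      = ∏ i ∈ Finset.range k, (stepScale 3 Lc i * (Lc : ℝ) ^ (3 + 1)) :=
    Finset.prod_congr rfl fun i hi => by
      rw [hlev (n + 1 - i) (Nat.sub_le _ _), Nat.sub_sub_self (by have := Finset.mem_range.mp hi; omega)]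
  have h2 : ∏ i ∈ Finset.Ico (n + 1 - k) (n + 1), (stepScale 3 Lc (n + 1 - (i + 1)) * (Lc : ℝ) ^ (3 + 1))
      = ∏ i ∈ Finset.Ico (n + 1 - k) (n + 1), (fun m => stepScale 3 Lc m * (Lc : ℝ) ^ (3 + 1)) (n - i) :=
    Finset.prod_congr rfl fun i _ => by rw [Nat.add_sub_add_right]
  rw [h1, h2, Finset.prod_Ico_reflect (fun m => stepScale 3 Lc m * (Lc : ℝ) ^ (3 + 1)) (n + 1 - k) le_rfl, Nat.sub_self,
    Nat.sub_sub_self hk, Nat.Ico_zero_eq_range]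

end Scalars

section Assembly

variable (P : Pins) (N₁ : ℕ) [NeZero N₁] (lev : ℕ → ℕ) (hlev : ∀ i ≤ n + 1, lev i = n + 1 - i)
  -- the road's brick list (as in `lamJunction_of_dper_eq`'s `hℓ`)
  (ℓ : ℕ → Fin (3 + 1) → Site (3 + 1) → Bond (3 + 1) → ℝ)
  (hℓ : ∀ i < n + 1, ∀ (μ : Fin (3 + 1)) (y : Site (3 + 1)) (g : Bond (3 + 1)),
    ℓ i μ y g = stepScale 3 Lc (lev (n + 1 - i)) * ((Lc : ℝ) ^ (3 + 1) * symLinKerAt (ctr (3 + 1) Lc) Lc μ y g))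
  -- the road's storey data (as in `TowerWeightWords.weight_word`, at `R := Roots.ctr Lc`)
  {κ : Type*} [Fintype κ] [DecidableEq κ] (yN : κ → Site (3 + 1)) (μN : κ → Fin (3 + 1))
  (hv : (κ → ℝ) → (↥(pbox (towerTorus Lc (fine Lc M) (n + 1))) × Fin (3 + 1) → ℝ))
  (cfF : ℕ → Fin (3 + 1) → Site (3 + 1) → Fin (3 + 1) → Site (3 + 1) → ℝ)
  (hcfF : ∀ (k : ℕ) (μ : Fin (3 + 1)) (s : Site (3 + 1)) (κ' : Fin (3 + 1)) (x : Site (3 + 1)), cfF k μ s κ' x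
    = if k = n + 1 then
        ∑ ν : Fin (3 + 1), ∑' w : Site (3 + 1), lamCoeffOf (KInv (N := Lc ^ (n + 1 + 1)) (d := 3)) (Lc ^ (n + 1 + 1)) ν w κ' x
          * compLinKer (fun _ => symLinKerAt (toSite (Roots.ctr Lc).r) Lc) Lc (n + 1) (μ, s) (ν, w)
      else (if x = (Lc : ℤ) • s ∧ κ' = μ then (1 : ℝ) else 0))
  (hbF : (k : ℕ) → (κ → ℝ) → (↥(pbox (towerTorus Lc (fine Lc M) k)) × Fin (3 + 1) → ℝ))
  (hhbF : ∀ (k : ℕ) (v : κ → ℝ) (ā : ↥(pbox (towerTorus Lc (fine Lc M) k)) × Fin (3 + 1)), hbF k v ā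
    = if k = n + 1 then hv v (wrapPt (towerTorus Lc (fine Lc M) (n + 1)) (ā.1 : Site (3 + 1)), ā.2)
      else ∑ y₀ : ↥(pbox (towerTorus Lc M k)), (if (ā.1 : Site (3 + 1)) = (Lc : ℤ) • (y₀ : Site (3 + 1)) then
        ∑ a : κ, v a * ∑' nn : Site (3 + 1), ∑ ν : Fin (3 + 1), ∑' w : Site (3 + 1),
          (∑ κ' : Fin (3 + 1), ∑' u' : Site (3 + 1),
              AN (Roots.ctr Lc) (n + 1) u' (((Lc ^ (n + 1 + 1) : ℕ) : ℤ) • yN a) (Sum.inl κ') (Sum.inr (μN a))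
                * lamCoeffOf (KInv (N := Lc ^ (n + 1 + 1)) (d := 3)) (Lc ^ (n + 1 + 1)) ν w κ' u')
            * compLinKer (fun _ => symLinKerAt (toSite (Roots.ctr Lc).r) Lc) Lc k (ā.2, translate (towerTorus Lc M k) (y₀ : Site (3 + 1)) nn) (ν, w)
        else 0))
  (c : ℝ) (κF wF : ℕ → ℝ)
  (hκF : ∀ k, κF k = ∏ i ∈ Finset.Ico k (n + 1), (stepScale 3 Lc (n + 1 - (i + 1)) * ((box (3 + 1) Lc).card : ℝ)))
  (hwF : ∀ k, wF k = (-(c * ((Lc : ℝ) ^ (3 + 1)) ^ (n + 1 + 1))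
      / ∏ i ∈ Finset.Ico k (n + 1), (stepScale 3 Lc (n + 1 - (i + 1)) * (Lc : ℝ) ^ (3 + 1))) / κF k)
  (T' : Fin (3 + 1) → ℕ) (hT' : ∀ i, towerTorus Lc (fine Lc M) (n + 1) i = Lc * T' i)
  (hhvl : ∀ (r : ℝ) (x y : κ → ℝ), hv (r • x + y) = r • hv x + hv y)
  (lam : κ → ↥(pbox (towerTorus Lc (fine Lc M) (n + 1))) → ℝ)
  (hJW : ∀ (a : κ) (b : ↥(pbox (towerTorus Lc (fine Lc M) (n + 1))) × Fin (3 + 1)), hv (Pi.single a 1) b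
      = perF (towerTorus Lc (fine Lc M) (n + 1)) (AN (Roots.ctr Lc) (n + 1)) (b.1, Sum.inl b.2)
          (wrapPt (towerTorus Lc (fine Lc M) (n + 1)) (((Lc ^ (n + 1 + 1) : ℕ) : ℤ) • yN a), Sum.inr (μN a))
        - ∑ s : ↥(pbox (towerTorus Lc (fine Lc M) (n + 1))), tgrad (towerTorus Lc (fine Lc M) (n + 1)) (b.1, Sum.inl b.2) s * lam a s)
  (hfold : ∀ (μ : Fin (3 + 1)) (y : Site (3 + 1)) (κ₁ : Fin (3 + 1)) (s₁ : Site (3 + 1)),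
      ∑ ā : ↥(pbox (towerTorus Lc (fine Lc M) (n + 1))) × Fin (3 + 1),
          perF (towerTorus Lc (fine Lc M) (n + 1)) (AN (Roots.ctr Lc) (n + 1)) (ā.1, Sum.inl ā.2)
              (wrapPt (towerTorus Lc (fine Lc M) (n + 1)) (((Lc ^ (n + 1 + 1) : ℕ) : ℤ) • y), Sum.inr μ)
            * (∑' m : Site (3 + 1), ∑ ν : Fin (3 + 1), ∑' w : Site (3 + 1),
                lamCoeffOf (KInv (N := Lc ^ (n + 1 + 1)) (d := 3)) (Lc ^ (n + 1 + 1)) ν w ā.2 (ā.1 : Site (3 + 1))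
                  * compLinKer (fun _ => symLinKerAt (toSite (Roots.ctr Lc).r) Lc) Lc (n + 1) (κ₁, translate T' s₁ m) (ν, w))
        = ∑' m : Site (3 + 1), ∑ ν : Fin (3 + 1), ∑' w : Site (3 + 1),
            (∑ κ' : Fin (3 + 1), ∑' u' : Site (3 + 1),
                AN (Roots.ctr Lc) (n + 1) u' (((Lc ^ (n + 1 + 1) : ℕ) : ℤ) • y) (Sum.inl κ') (Sum.inr μ)
                  * lamCoeffOf (KInv (N := Lc ^ (n + 1 + 1)) (d := 3)) (Lc ^ (n + 1 + 1)) ν w κ' u')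
              * compLinKer (fun _ => symLinKerAt (toSite (Roots.ctr Lc).r) Lc) Lc (n + 1) (κ₁, translate T' s₁ m) (ν, w))
  -- the pinned direction `r•e_a` and THE ONE SCALAR ROW (R-FP-81's top word)
  (r : ℝ) (htop : wF (n + 1) * r = P.cΛ (n + 1 + 1)) (a : κ)
  -- the road's storey-kernel display (as in `lamJunction_of_dper_eq`'s `h𝒦`, at the data)
  {𝒦 : ℕ → MKer (3 + 1) (Fin (3 + 1))}
  (h𝒦 : ∀ j ≤ n + 1, ∀ (β β' : Site (3 + 1)) (b b' : Fin (3 + 1)), 𝒦 j β β' b b'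
    = ∑ a₁ : Fin (3 + 1), ∑ a₁' : Fin (3 + 1), ∑' γ : Site (3 + 1), ∑' γ' : Site (3 + 1),
        compLinKer ℓ Lc (n + 1 - j) (b, β) (a₁, γ)
          * (wF j * ∑ ā : ↥(pbox (towerTorus Lc (fine Lc M) j)) × Fin (3 + 1),
              hbF j (r • (Pi.single a (1 : ℝ) : κ → ℝ)) ā
                * SLam N₁ (cfF j) (fun μ' y' => symHessFFAt (toSite (Roots.ctr Lc).r) Lc μ' y') ā.2 (ā.1 : Site (3 + 1)) γ γ' (Sum.inl a₁) (Sum.inl a₁'))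
          * compLinKer ℓ Lc (n + 1 - j) (b', β') (a₁', γ'))

include hcfF in
/-- [folklore] **`summable_cfF_slot` — PART 19's SLOT LETTER FOR THE ROAD's TABLES**: every storey coefficient is summable in its slot for EVERY site — at the top an2
PART 25 `NVertexLamFold.summable_cf_slot`, below the top the δ-table has at most one non-zero slot (`u = Lc•s`). -/
theorem summable_cfF_slot (k : ℕ) (ν κ' : Fin (3 + 1)) (u : Site (3 + 1)) : Summable fun s : Site (3 + 1) => cfF k ν s κ' u := by
  have hL0 : (Lc : ℤ) ≠ 0 := by exact_mod_cast NeZero.ne Lc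
  by_cases hk : k = n + 1
  · subst hk
    simp only [hcfF, if_true]
    exact summable_cf_slot (Roots.ctr Lc) (n + 1) ν κ' u
  · simp only [hcfF, if_neg hk]
    refine summable_of_ne_finset_zero (s := {fun i => u i / (Lc : ℤ)}) fun s hs => ?_
    rw [Finset.mem_singleton] at hs
    rw [if_neg]
    rintro ⟨h1, -⟩
    apply hs
    funext i
    have hi := congrFun h1 i
    simp only [Pi.smul_apply, smul_eq_mul] at hi
    rw [hi, Int.mul_ediv_cancel_left _ hL0]

/-! ## §2 One storey: row index `k` (= the leg depth), road storey `n+1−k`, storey torus `Tc := towerTorus Lc (fine Lc M) (n+1−k)` over the slot torus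
`towerTorus Lc M (n+1−k)`, finest torus `Tf := towerTorus Lc Tc k` (= `T`, `towerTorus_sub_add`) -/

include hℓ in
/-- [folklore] the road's depth-`k` leg is the record's leg times the storey scalar (PART 17 `compLinKer_road_eq_scaled`), hence vanishes off F6a″'s upper box (PART 15). -/
theorem roadLeg_eq_zero_of_not_mem_box (k : ℕ) (hk : k ≤ n + 1) (γ : Site (3 + 1)) (a₁ : Fin (3 + 1)) (β : Site (3 + 1)) (b : Fin (3 + 1))
    (hγ : γ ∉ Fintype.piFinset fun i => Finset.Icc ((β i - (wid Lc k : ℤ)) / ((Lc ^ k : ℕ) : ℤ)) (β i / ((Lc ^ k : ℕ) : ℤ))) :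
    compLinKer ℓ Lc k (b, β) (a₁, γ) = 0 := by
  rw [compLinKer_road_eq_scaled Lc n lev hℓ k hk,
    compLinKer_eq_zero_of_not_mem_box (Nat.pos_of_ne_zero (NeZero.ne Lc)) k (b, β) a₁ hγ, mul_zero]

omit [∀ i, NeZero (M i)] in
include hℓ in
/-- [folklore] the road's depth-`k` leg is two-scale equivariant between the storey torus `Tc` and `Tf = towerTorus Lc Tc k` (PART 17 `compLinKer_translate_of_sh` × the scalar). -/
theorem roadLeg_translate (k : ℕ) (hk : k ≤ n + 1) (m γ : Site (3 + 1)) (a₁ : Fin (3 + 1)) (β : Site (3 + 1)) (b : Fin (3 + 1)) :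
    compLinKer ℓ Lc k (b, translate (towerTorus Lc (towerTorus Lc (fine Lc M) (n + 1 - k)) k) β m)
        (a₁, translate (towerTorus Lc (fine Lc M) (n + 1 - k)) γ m)
      = compLinKer ℓ Lc k (b, β) (a₁, γ) := by
  rw [compLinKer_road_eq_scaled Lc n lev hℓ k hk, compLinKer_road_eq_scaled Lc n lev hℓ k hk,
    compLinKer_translate_of_sh (fun _ μ' y' t f => symLinKerAt_add (toSite (Roots.ctr Lc).r) Lc μ' y' t f) (towerTorus Lc (fine Lc M) (n + 1 - k)) k m γ a₁ β b]

omit [∀ i, NeZero (M i)] [NeZero N₁] [Fintype κ] in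
include h𝒦 in
/-- [folklore] the road's window-free storey display at storey `n+1−k`, with the leg depth written `k` (`Nat.sub_sub_self`). -/
theorem storeyKernel_display (k : ℕ) (hk : k ≤ n + 1) (β β' : Site (3 + 1)) (b b' : Fin (3 + 1)) :
    𝒦 (n + 1 - k) β β' b b' = ∑ a₁ : Fin (3 + 1), ∑ a₁' : Fin (3 + 1), ∑' γ : Site (3 + 1), ∑' γ' : Site (3 + 1),
        compLinKer ℓ Lc k (b, β) (a₁, γ)
          * (wF (n + 1 - k) * ∑ ā : ↥(pbox (towerTorus Lc (fine Lc M) (n + 1 - k))) × Fin (3 + 1),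
              hbF (n + 1 - k) (r • (Pi.single a (1 : ℝ) : κ → ℝ)) ā
                * SLam N₁ (cfF (n + 1 - k)) (fun μ' y' => symHessFFAt (toSite (Roots.ctr Lc).r) Lc μ' y') ā.2 (ā.1 : Site (3 + 1)) γ γ'
                  (Sum.inl a₁) (Sum.inl a₁'))
          * compLinKer ℓ Lc k (b', β') (a₁', γ') := by
  rw [h𝒦 (n + 1 - k) (Nat.sub_le _ _)]
  simp only [Nat.sub_sub_self hk]

omit [Fintype κ] in
include hcfF in
/-- [folklore] the road's storey core's diagonal letter on its storey torus (PART 19 `summable_slamCore_diag`, slot letter `summable_cfF_slot`). -/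
theorem summable_roadCore_diag (j : ℕ) (γ γ' : Site (3 + 1)) (a₁ a₁' : Fin (3 + 1)) :
    Summable fun m₀ : Site (3 + 1) =>
      (fun x x' (cc cc' : Fin (3 + 1)) => wF j * ∑ ā : ↥(pbox (towerTorus Lc (fine Lc M) j)) × Fin (3 + 1),
          hbF j (r • (Pi.single a (1 : ℝ) : κ → ℝ)) ā
            * SLam N₁ (cfF j) (fun μ' y' => symHessFFAt (toSite (Roots.ctr Lc).r) Lc μ' y') ā.2 (ā.1 : Site (3 + 1)) x x' (Sum.inl cc) (Sum.inl cc'))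
        (translate (towerTorus Lc (fine Lc M) j) γ m₀) (translate (towerTorus Lc (fine Lc M) j) γ' m₀) a₁ a₁' :=
  summable_slamCore_diag (N₁ := N₁) (Roots.ctr Lc).hr (Nat.pos_of_ne_zero (NeZero.ne Lc)) (cfF j) (wF j)
    (hbF j (r • (Pi.single a (1 : ℝ) : κ → ℝ))) (fun ā => ā.2) (fun ā => (ā.1 : Site (3 + 1)))
    (towerTorus Lc (fine Lc M) j) (towerTorus Lc M j) (fun ν ā => summable_cfF_slot n cfF hcfF j ν ā.2 (ā.1 : Site (3 + 1)))
    (towerTorus_fine_apply_eq M j) (fun _ => one_le_of_neZero _) γ γ' a₁ a₁'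

omit [Fintype κ] in
include hℓ hcfF h𝒦 in
/-- [folklore] **THE STOREY KERNEL's DIAGONAL LETTER ON THE FINEST TORUS** `T = towerTorus Lc (fine Lc M) (n+1)` (the engine's `summable_sandwich_diag_of_tsum` at
`Tc`, `Tf = towerTorus Lc Tc k`, re-based by `towerTorus_sub_add`). -/
theorem summable_storeyKernel_diag (k : ℕ) (hk : k ≤ n + 1) (β β' : Site (3 + 1)) (b b' : Fin (3 + 1)) :
    Summable fun m₀ : Site (3 + 1) =>
      𝒦 (n + 1 - k) (translate (towerTorus Lc (fine Lc M) (n + 1)) β m₀) (translate (towerTorus Lc (fine Lc M) (n + 1)) β' m₀) b b' := by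
  have h := summable_sandwich_diag_of_tsum (towerTorus Lc (fine Lc M) (n + 1 - k)) (towerTorus Lc (towerTorus Lc (fine Lc M) (n + 1 - k)) k)
    (fun γ a₁ β b => compLinKer ℓ Lc k (b, β) (a₁, γ)) (roadLeg_translate n M lev ℓ hℓ k hk)
    (fun β => Fintype.piFinset fun i => Finset.Icc ((β i - (wid Lc k : ℤ)) / ((Lc ^ k : ℕ) : ℤ)) (β i / ((Lc ^ k : ℕ) : ℤ)))
    (fun γ a₁ β b h => roadLeg_eq_zero_of_not_mem_box n lev ℓ hℓ k hk γ a₁ β b h)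
    (fun x x' (cc cc' : Fin (3 + 1)) => wF (n + 1 - k) * ∑ ā : ↥(pbox (towerTorus Lc (fine Lc M) (n + 1 - k))) × Fin (3 + 1),
        hbF (n + 1 - k) (r • (Pi.single a (1 : ℝ) : κ → ℝ)) ā
          * SLam N₁ (cfF (n + 1 - k)) (fun μ' y' => symHessFFAt (toSite (Roots.ctr Lc).r) Lc μ' y') ā.2 (ā.1 : Site (3 + 1)) x x' (Sum.inl cc) (Sum.inl cc'))
    (storeyKernel_display n M N₁ ℓ cfF hbF wF r a h𝒦 k hk) (summable_roadCore_diag n M N₁ cfF hcfF hbF wF r a (n + 1 - k)) β β' b b'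
  rwa [towerTorus_sub_add (n + 1) M hk] at h

include hlev hℓ hcfF hhbF hκF hwF hT' hhvl hJW hfold htop h𝒦 in
/-- [folklore] **`dper_storeyKernel_eq_dper_storeySandwichR` — ONE STOREY OF `hΛN`**: on `Tf = towerTorus Lc (towerTorus Lc (fine Lc M) (n+1−k)) k`, the diagonal
periodisation of the road's storey kernel `𝒦 (n+1−k)` IS that of the row's storey sandwich `𝒦ᴿ_k` (an2 PART 17's summand), entrywise: the road's engine
`dper_sandwich_apply` on the left (legs `roadLeg_translate ∕ roadLeg_eq_zero_of_not_mem_box`, core letter `summable_roadCore_diag`), PART 17 `dper_storeySandwichR_apply`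
on the right, and in the middle the two leg scalars (`compLinKer_road_eq_scaled`, `legScalar_prod_eq`) × PART 19 `dper_slamCore_eq_dper_lamCoreR_of_word` fed with
road g41 `TowerWeightWords.weight_word` at storey `n+1−k`. -/
theorem dper_storeyKernel_eq_dper_storeySandwichR (k : ℕ) (hk : k ≤ n + 1) (β β' : Site (3 + 1)) (b b' : Fin (3 + 1)) :
    dper (towerTorus Lc (towerTorus Lc (fine Lc M) (n + 1 - k)) k) (𝒦 (n + 1 - k)) β β' b b'
      = dper (towerTorus Lc (towerTorus Lc (fine Lc M) (n + 1 - k)) k)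
          (fun x' z' (a₀ b₀ : Fin (3 + 1)) => ∑ a₁ : Fin (3 + 1), ∑ a₁' : Fin (3 + 1), ∑' γ : Site (3 + 1), ∑' γ' : Site (3 + 1),
            compLinKer (fun _ => symLinKerAt (toSite (Roots.ctr Lc).r) Lc) Lc k (a₀, x') (a₁, γ)
              * (-(P.cΛ (n + 1 + 1)) * ∑ κ₀ : Fin (3 + 1), ∑' s : Site (3 + 1),
                  (∑ ν : Fin (3 + 1), ∑' w : Site (3 + 1),
                      (∑ κ' : Fin (3 + 1), ∑' u : Site (3 + 1),
                          AN (Roots.ctr Lc) (n + 1) u (((Lc ^ (n + 1 + 1) : ℕ) : ℤ) • yN a) (Sum.inl κ') (Sum.inr (μN a))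
                            * lamCoeffOf (KInv (N := Lc ^ (n + 1 + 1)) (d := 3)) (Lc ^ (n + 1 + 1)) ν w κ' u)
                        * compLinKer (fun _ => symLinKerAt (toSite (Roots.ctr Lc).r) Lc) Lc (n + 1 - k) (κ₀, s) (ν, w))
                    * symHessKerAt (toSite (Roots.ctr Lc).r) Lc κ₀ s (a₁, γ) (a₁', γ'))
              * compLinKer (fun _ => symLinKerAt (toSite (Roots.ctr Lc).r) Lc) Lc k (b₀, z') (a₁', γ')) β β' b b' := by
  rw [dper_sandwich_apply (towerTorus Lc (fine Lc M) (n + 1 - k)) (towerTorus Lc (towerTorus Lc (fine Lc M) (n + 1 - k)) k)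
    (fun γ a₁ β b => compLinKer ℓ Lc k (b, β) (a₁, γ)) (roadLeg_translate n M lev ℓ hℓ k hk)
    (fun β => Fintype.piFinset fun i => Finset.Icc ((β i - (wid Lc k : ℤ)) / ((Lc ^ k : ℕ) : ℤ)) (β i / ((Lc ^ k : ℕ) : ℤ)))
    (fun γ a₁ β b h => roadLeg_eq_zero_of_not_mem_box n lev ℓ hℓ k hk γ a₁ β b h)
    (fun x x' (cc cc' : Fin (3 + 1)) => wF (n + 1 - k) * ∑ ā : ↥(pbox (towerTorus Lc (fine Lc M) (n + 1 - k))) × Fin (3 + 1),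
        hbF (n + 1 - k) (r • (Pi.single a (1 : ℝ) : κ → ℝ)) ā
          * SLam N₁ (cfF (n + 1 - k)) (fun μ' y' => symHessFFAt (toSite (Roots.ctr Lc).r) Lc μ' y') ā.2 (ā.1 : Site (3 + 1)) x x' (Sum.inl cc) (Sum.inl cc'))
    (sandwich_tsum_eq_window (fun γ a₁ β b => compLinKer ℓ Lc k (b, β) (a₁, γ))
      (fun β => Fintype.piFinset fun i => Finset.Icc ((β i - (wid Lc k : ℤ)) / ((Lc ^ k : ℕ) : ℤ)) (β i / ((Lc ^ k : ℕ) : ℤ)))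
      (fun γ a₁ β b h => roadLeg_eq_zero_of_not_mem_box n lev ℓ hℓ k hk γ a₁ β b h) _ (storeyKernel_display n M N₁ ℓ cfF hbF wF r a h𝒦 k hk))
    (summable_roadCore_diag n M N₁ cfF hcfF hbF wF r a (n + 1 - k)) β β' b b']
  refine Eq.trans ?_ (dper_storeySandwichR_apply (Roots.ctr Lc) P (n + 1) (towerTorus Lc (fine Lc M) (n + 1 - k)) (towerTorus Lc M (n + 1 - k))
    (towerTorus_fine_apply_eq M (n + 1 - k)) k (μN a) (yN a) β β' b b').symm
  refine Finset.sum_congr rfl fun a₁ _ => Finset.sum_congr rfl fun a₁' _ => Finset.sum_congr rfl fun γ _ => Finset.sum_congr rfl fun γ' _ => ?_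
  -- the storey CORE identity (PART 19) at the road's two-leg scalar, fed with the weight word of storey `n+1−k`
  have h19 := dper_slamCore_eq_dper_lamCoreR_of_word (N₁ := N₁) (Roots.ctr Lc) P (n + 1) (cfF (n + 1 - k)) (wF (n + 1 - k))
    (hbF (n + 1 - k) (r • (Pi.single a (1 : ℝ) : κ → ℝ))) (fun ā => ā.2) (fun ā => (ā.1 : Site (3 + 1)))
    (towerTorus Lc (fine Lc M) (n + 1 - k)) (towerTorus Lc M (n + 1 - k))
    (fun ν ā => summable_cfF_slot n cfF hcfF (n + 1 - k) ν ā.2 (ā.1 : Site (3 + 1))) (towerTorus_fine_apply_eq M (n + 1 - k))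
    ((∏ i ∈ Finset.range k, (stepScale 3 Lc (lev (n + 1 - i)) * (Lc : ℝ) ^ (3 + 1))) ^ 2) k (μN a) (yN a)
    (fun κ₀ ρ => by
      rw [legScalar_prod_eq n lev hlev k hk]
      exact weight_word (Roots.ctr Lc) n M yN μN hv cfF hcfF hbF hhbF c κF wF hκF hwF T' hT' hhvl lam hJW hfold (P.cΛ (n + 1 + 1)) r htop
        (n + 1 - k) (Nat.sub_le _ _) a κ₀ ρ)
    γ γ' a₁ a₁'
  rw [compLinKer_road_eq_scaled Lc n lev hℓ k hk (b, β) (a₁, γ), compLinKer_road_eq_scaled Lc n lev hℓ k hk (b', β') (a₁', γ'), ← h19]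
  ring

/-! ## §3 The sum: `hΛN` -/

include hlev hℓ hcfF hhbF hκF hwF hT' hhvl hJW hfold htop h𝒦 in
/-- [folklore] **`dper_sum_storeyKernels_eq_dper_lamN` — `hΛN` AT THE ROAD's DATA ((E4b) proper: the hypothesis of `TorusLamJunctionShape.lamJunction_of_dper_eq`)**:
on `T = towerTorus Lc (fine Lc M) (n+1)`,
`dper T (Σ_{j ∈ range (n+2)} 𝒦_j) = dper T (x z a b ↦ Pn.cΛ (n+2)·Σ_{b₁} colN̂ b₁·SLam (Lc^(n+2)) (lamCoeffOf (KInv (Lc^(n+2))) (Lc^(n+2))) (compH (Roots.ctr Lc).r Lc (n+2)) b₁.2 b₁.1 x z (inl a) (inl b))`,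
`colN̂ b₁ = perF T (AN (Roots.ctr Lc) (n+1)) (b₁♭, (wrapPt T (Lc^(n+2)•yN a), inr (μN a)))` — the storey sum re-indexed (`Finset.sum_range_reflect`) and taken out of `dper T`
(`summable_storeyKernel_diag`), §2 storey by storey, an2 PART 17 `dper_lamN_eq_sum_dper_storeys` on the right. -/
theorem dper_sum_storeyKernels_eq_dper_lamN :
    dper (towerTorus Lc (fine Lc M) (n + 1)) (∑ j ∈ Finset.range (n + 1 + 1), 𝒦 j)
      = dper (towerTorus Lc (fine Lc M) (n + 1)) (fun x z (a₀ b₀ : Fin (3 + 1)) => P.cΛ (n + 1 + 1) *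
          ∑ b₁ : ↥(pbox (towerTorus Lc (fine Lc M) (n + 1))) × Fin (3 + 1),
            perF (towerTorus Lc (fine Lc M) (n + 1)) (AN (Roots.ctr Lc) (n + 1)) (b₁.1, Sum.inl b₁.2)
                (wrapPt (towerTorus Lc (fine Lc M) (n + 1)) (((Lc ^ (n + 1 + 1) : ℕ) : ℤ) • yN a), Sum.inr (μN a)) *
              SLam (Lc ^ (n + 1 + 1)) (lamCoeffOf (KInv (N := Lc ^ (n + 1 + 1)) (d := 3)) (Lc ^ (n + 1 + 1))) (compH (Roots.ctr Lc).r Lc (n + 1 + 1)) b₁.2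
                (b₁.1 : Site (3 + 1)) x z (Sum.inl a₀) (Sum.inl b₀)) := by
  funext x z a₀ b₀
  refine Eq.trans ?_ (dper_lamN_eq_sum_dper_storeys (Roots.ctr Lc) P (n + 1) M (μN a) (yN a) x z a₀ b₀).symm
  rw [← Finset.sum_range_reflect 𝒦 (n + 1 + 1), Nat.add_sub_cancel, dper_apply]
  simp only [Finset.sum_apply]
  rw [Summable.tsum_finsetSum (fun k hk => summable_storeyKernel_diag n M N₁ lev ℓ hℓ cfF hcfF hbF wF r a h𝒦 k
    (Nat.lt_succ_iff.mp (Finset.mem_range.mp hk)) x z a₀ b₀)]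
  refine Finset.sum_congr rfl fun k hk => ?_
  have hk' : k ≤ n + 1 := Nat.lt_succ_iff.mp (Finset.mem_range.mp hk)
  refine Eq.trans ?_ (dper_storeyKernel_eq_dper_storeySandwichR n M P N₁ lev hlev ℓ hℓ yN μN hv cfF hcfF hbF hhbF c κF wF hκF hwF T' hT' hhvl lam
    hJW hfold r htop a h𝒦 k hk' x z a₀ b₀)
  rw [dper_apply, towerTorus_sub_add (n + 1) M hk']

end Assembly

end Summit.QuantumFields.BalabanUV.Beta.FP.TowerLamJunctionAssembly

end
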